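import Summits.Ventures.PercRepro.MSTightOneVertexAnatomy

/-!
# The one-outside-vertex case (Theorem B of Addendum 38 §4), part III: the injection (e2)

Dossier proofs/MINE1-theoremS.md, Addendum 38 §4 (e2) in the simplified form of Addendum 40 (iv).
For a one-vertex residue instance (MSTightOneVertexSetup.lean) let `P₁ = T₁ ∖ T₀` be the
partnerless members through `m` and `𝒫'' = {t ∈ P₁ : I ⊆ t}`. For `t ∈ 𝒫''` put
`δ t = R ∖ t` when `t ⊆ R` (then `R ∈ T₀` and `R ∖ t = R ∖ (t ∪ m)` is a difference) and
`δ t = u ∖ t` otherwise (then `u ∖ (t ∖ R) ∈ T₀` and `u ∖ t` is its difference with `t ∪ m`).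
In both cases `δ t ∈ D(P) ∖ Λ` — its `R`-part is `R ∖ t ∉ Y` because `t ∉ T₀` — and `δ t` is
disjoint from `I ⊆ t`; `δ` is injective on `𝒫''` (`δ t` meets `N = u ∖ R` exactly when
`t ⊄ R`, as no member of `T₁` contains `N`).
-/

namespace PercRepro.MSTight

open Finset
open scoped FinsetFamily

variable {α : Type*} [DecidableEq α] [Fintype α]

namespace OneVertexData

variable {u : Finset α} {L' T : Finset (Finset α)} {m : α}

/-- The map `δ` of (e2): `R ∖ t` when `t ⊆ R`, else `u ∖ t`. -/
def delta (u : Finset α) (T : Finset (Finset α)) (m : α) (t : Finset α) : Finset α :=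
  if t ⊆ Rstar (partner m T) then Rstar (partner m T) \ t else u \ t

omit [Fintype α] in
/-- The difference of a member inside `u` and a member through `m` (with `m` removed) is a
difference avoiding `m`. -/
theorem sdiff_mem_diffsX_of_mem_part0_of_mem_partr {x t : Finset α} (hx : x ∈ part0 m T)
    (ht : t ∈ partr m T) : x \ t ∈ diffsX m T := by
  obtain ⟨hxT, hmx⟩ := mem_part0.1 hx
  obtain ⟨-, htT⟩ := mem_partr.1 ht
  refine mem_diffsX_iff.2 ⟨?_, fun h => hmx (mem_sdiff.1 h).1⟩
  refine mem_diffs.2 ⟨x, hxT, insert m t, htT, ?_⟩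
  ext a
  simp only [mem_sdiff, mem_insert, not_or]
  constructor
  · rintro ⟨hax, hne, hat⟩; exact ⟨hax, hat⟩
  · rintro ⟨hax, hat⟩; exact ⟨hax, fun h => hmx (h ▸ hax), hat⟩

/-- A member of `T₁` is not `u`. -/
theorem ne_of_mem_partr (d : OneVertexData u L' T m) {t : Finset α} (ht : t ∈ partr m T) :
    t ≠ u := by
  intro h
  exact d.not_sdiff_subset_of_mem_partr ht (h ▸ sdiff_subset)

/-- A member of `T₁` lies outside `T₀` iff `R ∖ t ∉ Y`. -/
theorem notMem_part0_iff_of_mem_partr (d : OneVertexData u L' T m) {t : Finset α}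
    (ht : t ∈ partr m T) : t ∉ part0 m T ↔ Rstar (partner m T) \ t ∉ diffsY m T := by
  rw [d.mem_part0_iff']
  have h1 := d.subset_of_mem_partr ht
  have h2 := d.ne_of_mem_partr ht
  tauto

/-- `R ∈ T₀`. -/
theorem Rstar_mem_part0 (d : OneVertexData u L' T m) : Rstar (partner m T) ∈ part0 m T :=
  (mem_inter.1 d.Rstar_mem).1

/-- `u ∖ (t ∖ R) ∈ T₀` for every `t ⊆ u` meeting `N`. -/
theorem sdiff_sdiff_mem_part0 (d : OneVertexData u L' T m) {t : Finset α} (htu : t ⊆ u)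
    (htR : ¬ t ⊆ Rstar (partner m T)) : u \ (t \ Rstar (partner m T)) ∈ part0 m T := by
  rw [d.mem_part0_iff']
  refine ⟨sdiff_subset, ?_, ?_⟩
  · intro h
    obtain ⟨a, hat, haR⟩ := not_subset.1 htR
    have : a ∈ u \ (t \ Rstar (partner m T)) := by rw [h]; exact htu hat
    exact (mem_sdiff.1 this).2 (mem_sdiff.2 ⟨hat, haR⟩)
  · have : Rstar (partner m T) \ (u \ (t \ Rstar (partner m T))) = ∅ := by
      rw [sdiff_eq_empty_iff_subset]
      intro a haR
      exact mem_sdiff.2 ⟨d.Rstar_subset haR, fun h => (mem_sdiff.1 h).2 haR⟩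
    rw [this]; exact d.empty_mem_diffsY

/-- **(e2), membership.** For `t ∈ 𝒫''`, `δ t ∈ D(P) ∖ Λ`. -/
theorem delta_mem (d : OneVertexData u L' T m) {t : Finset α} (ht : t ∈ partr m T)
    (ht0 : t ∉ part0 m T) :
    delta u T m t ∈ diffsX m T \ link (upSet (insert m u) L') u := by
  have hRt := (d.notMem_part0_iff_of_mem_partr ht).1 ht0
  have htu := d.subset_of_mem_partr ht
  unfold delta
  split_ifs with htR
  · refine mem_sdiff.2 ⟨sdiff_mem_diffsX_of_mem_part0_of_mem_partr d.Rstar_mem_part0 ht, ?_⟩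
    rw [d.mem_link_iff']
    rintro ⟨-, h⟩
    rw [inter_eq_left.2 sdiff_subset] at h
    exact hRt h
  · have h1 := sdiff_mem_diffsX_of_mem_part0_of_mem_partr (d.sdiff_sdiff_mem_part0 htu htR) ht
    have heq : (u \ (t \ Rstar (partner m T))) \ t = u \ t := by
      ext a
      simp only [mem_sdiff, not_and, not_not]
      tauto
    rw [heq] at h1
    refine mem_sdiff.2 ⟨h1, ?_⟩
    rw [d.mem_link_iff']
    rintro ⟨-, h⟩
    have : (u \ t) ∩ Rstar (partner m T) = Rstar (partner m T) \ t := by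
      ext a
      simp only [mem_inter, mem_sdiff]
      constructor
      · rintro ⟨⟨-, hat⟩, haR⟩; exact ⟨haR, hat⟩
      · rintro ⟨haR, hat⟩; exact ⟨⟨d.Rstar_subset haR, hat⟩, haR⟩
    rw [this] at h
    exact hRt h

/-- **(e2), disjointness from `I`.** For `t ⊇ I`, `δ t` is disjoint from `I`. -/
theorem disjoint_delta_I {t : Finset α} (hIt : I u L' m ⊆ t) :
    Disjoint (I u L' m) (delta u T m t) := by
  unfold delta
  split_ifs
  · exact disjoint_of_subset_left hIt disjoint_sdiff_self_right
  · exact disjoint_of_subset_left hIt disjoint_sdiff_self_right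

/-- `δ t` meets `N = u ∖ R` iff `t ⊄ R` (for `t ∈ T₁`). -/
theorem delta_inter_sdiff (d : OneVertexData u L' T m) {t : Finset α} (ht : t ∈ partr m T) :
    (delta u T m t ∩ (u \ Rstar (partner m T))).Nonempty ↔ ¬ t ⊆ Rstar (partner m T) := by
  unfold delta
  split_ifs with htR
  · simp only [htR, not_true_eq_false, iff_false]
    rw [not_nonempty_iff_eq_empty, eq_empty_iff_forall_notMem]
    intro a ha
    rw [mem_inter, mem_sdiff, mem_sdiff] at ha
    exact ha.2.2 ha.1.1
  · simp only [htR, not_false_eq_true, iff_true]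
    obtain ⟨a, haN, hat⟩ := not_subset.1 (d.not_sdiff_subset_of_mem_partr ht)
    exact ⟨a, mem_inter.2 ⟨mem_sdiff.2 ⟨(mem_sdiff.1 haN).1, hat⟩, haN⟩⟩

/-- **(e2), injectivity.** `δ` is injective on `𝒫'' = {t ∈ P₁ : I ⊆ t}` (indeed on `T₁`). -/
theorem delta_injOn (d : OneVertexData u L' T m) :
    Set.InjOn (delta u T m) ↑((partr m T \ part0 m T).filter fun t => I u L' m ⊆ t) := by
  intro t ht t' ht' h
  have htP : t ∈ partr m T := (mem_sdiff.1 (mem_filter.1 (mem_coe.1 ht)).1).1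
  have ht'P : t' ∈ partr m T := (mem_sdiff.1 (mem_filter.1 (mem_coe.1 ht')).1).1
  have htu := d.subset_of_mem_partr htP
  have ht'u := d.subset_of_mem_partr ht'P
  have hiff := d.delta_inter_sdiff htP
  have hiff' := d.delta_inter_sdiff ht'P
  rw [h] at hiff
  have hcase : (t ⊆ Rstar (partner m T)) ↔ (t' ⊆ Rstar (partner m T)) := by
    rw [← not_iff_not, ← hiff, ← hiff']
  unfold delta at h
  by_cases htR : t ⊆ Rstar (partner m T)
  · have ht'R : t' ⊆ Rstar (partner m T) := hcase.1 htR
    rw [if_pos htR, if_pos ht'R] at h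
    exact eq_of_sdiff_eq_of_subset htR ht'R h
  · have ht'R : ¬ t' ⊆ Rstar (partner m T) := fun h' => htR (hcase.2 h')
    rw [if_neg htR, if_neg ht'R] at h
    exact eq_of_sdiff_eq_of_subset htu ht'u h

end OneVertexData

end PercRepro.MSTight
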